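import Literature.Barriers.AtomisticToContinuum.WildSolutions
import Literature.Analysis.FluidPDE.ConvexIntegration2DReduction
import Literature.Analysis.FluidPDE.FanPartitionCalculus
import Literature.Analysis.FluidPDE.SymmetricTwoShock
import HarnessLib

/-!
# Wild solutions of 2-D full Euler from symmetric two-shock Riemann data: the gluing step

`Literature/Barriers/AtomisticToContinuum/WildSolutionsProofs.lean` — proofs only (no new
definitions) for the barrier `WildSolutionsBarrier` of
`Literature/Barriers/AtomisticToContinuum/WildSolutions.lean` (Markfelder, LNM 2294 (2021),
Thm 8.3.1 for the data `ρ± = p± = 1`, `u± = (0, ±a)`, `1 < γ < 3`).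

Main result: `WildSolutionsBarrier_of_convexIntegrationLemma2D`, the barrier from the single
named fact `Literature.Analysis.FluidPDE.ConvexIntegration.ConvexIntegrationLemma2D`
(Chiodaroli–De Lellis–Kreml 2015, Lemma 3.7 = Markfelder 2021, Thm 5.3.1 for constant planar
subsolutions; file `Literature/Analysis/FluidPDE/ConvexIntegration2D.lean`). Everything else in
Markfelder's proof of Thm 8.3.1 is proved in the tree:

* the Rankine–Hugoniot bookkeeping on a three-region fan partition
  (`Literature/Analysis/FluidPDE/FanPartitionCalculus.lean`: `fan_weakForm_eq_zero`,
  `fan_weakForm_nonpos`, `setIntegral_halfSpace_eq_fan`; Markfelder Prop. 8.3.5);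
* the parameters of a symmetric admissible fan subsolution
  (`Literature/Analysis/FluidPDE/SymmetricTwoShock.lean`: `exists_fan_parameters`; Markfelder
  Prop. 8.1.2, (8.6)–(8.10), Prop. 8.3.8, §8.3.3);
* here: Markfelder's Thm 8.3.4 for this fan — paste a wild velocity field of the middle wedge
  `Γ₁ = {t > 0, -σt < y < σt}` (from the convex-integration lemma with `v₀ = 0`,
  `u₀ = diag(g, -g)`, `C = 2e`) between the constant outer states, and check Definition 3.2.5
  (mass (3.63), momentum (3.64), energy (3.65), entropy inequalities (3.66)) region by region:
  on `Γ±` the fields are constant, on `Γ₁` the density/pressure are the constants `(R, P)`,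
  `|u|² = 2e` a.e., `∫_{Γ₁} u · ∇φ = 0` and
  `∫_{Γ₁} [u · ∂ₜw + u ⊗ u : ∇w] = ∫_{Γ₁} (e Id + diag(g, -g)) : ∇w`, so every balance law
  reduces to the fan identity with the Rankine–Hugoniot defects delivered by
  `exists_fan_parameters` (Markfelder 2021, proof of Thm 8.3.4 via proof of Thm 7.3.4,
  pp. 164–167 and 192–194).

For the symmetric data the two middle wedges of Markfelder's Def. 8.3.2 carry the same state and
the interface `y = 0` carries no jump, so a three-region fan (CDK 2015, Def. 3.3) suffices and
the convex-integration lemma is applied once, on `Γ₁`.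

The discharge `WildSolutionsBarrier_holds` is then the one-liner
`WildSolutionsBarrier_of_convexIntegrationLemma2D h` from a proof `h` of the convex-integration
lemma (not yet in the tree; decomposed in `Literature/Analysis/FluidPDE/ConvexIntegration2D*.lean`).

## References

* S. Markfelder, *Convex Integration Applied to the Multi-Dimensional Compressible Euler
  Equations*, LNM 2294 (2021), Def. 3.2.5, Thm 5.3.1, Def. 8.3.2–8.3.3, Thm 8.3.1, Thm 8.3.4,
  Prop. 8.3.5, §8.3.3.
* E. Chiodaroli, C. De Lellis, O. Kreml, Comm. Pure Appl. Math. 68 (2015) 1157–1190, Lemma 3.7,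
  Prop. 3.6.
-/

noncomputable section

open MeasureTheory Set Filter
open Literature.Analysis.FluidPDE Literature.Analysis.FluidPDE.FanPartition
  Literature.Analysis.FluidPDE.ConvexIntegration Literature.Analysis.FunctionSpaces

namespace Literature.Barriers.AtomisticToContinuum

open FullEuler2D

/-- The lower fan region `Γ₋ = {t > 0, y < -σ t}`. -/
local notation3 "Γₘ[" s "]" =>
  {z : ℝ × EuclideanSpace ℝ (Fin 2) | 0 < z.1 ∧ z.2 1 < -s * z.1}
/-- The middle wedge `Γ₁ = {t > 0, -σ t < y < σ t}`. -/
local notation3 "Γ₁[" s "]" =>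
  {z : ℝ × EuclideanSpace ℝ (Fin 2) | 0 < z.1 ∧ -s * z.1 < z.2 1 ∧ z.2 1 < s * z.1}
/-- The upper fan region `Γ₊ = {t > 0, y > σ t}`. -/
local notation3 "Γₚ[" s "]" =>
  {z : ℝ × EuclideanSpace ℝ (Fin 2) | 0 < z.1 ∧ s * z.1 < z.2 1}

/-! ### Test functions and their components -/

section TestFunctions

variable {φ : ℝ × EuclideanSpace ℝ (Fin 2) → ℝ}
  {w : ℝ × EuclideanSpace ℝ (Fin 2) → EuclideanSpace ℝ (Fin 2)}

/-- A test function is `C¹`. [folklore] -/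
theorem contDiff_one_of_isTestFunction {F : Type*} [NormedAddCommGroup F] [NormedSpace ℝ F]
    {ψ : SpaceTime → F} (hψ : IsTestFunction ψ) : ContDiff ℝ 1 ψ :=
  hψ.contDiff.of_le (by exact_mod_cast le_top)

/-- The components of an `ℝ²`-valued test function are real test functions. [folklore] -/
theorem isTestFunction_apply (hw : IsTestFunction w) (i : Fin 2) :
    IsTestFunction (fun z => w z i) where
  contDiff := by
    have h : (fun z => w z i) =
        (EuclideanSpace.proj i : EuclideanSpace ℝ (Fin 2) →L[ℝ] ℝ) ∘ w := by
      ext z; simp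
    rw [h]
    exact (EuclideanSpace.proj i).contDiff.comp hw.contDiff
  hasCompactSupport :=
    hw.hasCompactSupport.comp_left (g := fun b : EuclideanSpace ℝ (Fin 2) => b i) rfl
  tsupport_subset := fun _ _ => trivial

/-- Components of the Fréchet derivative of an `ℝ²`-valued `C¹` map are the derivatives of its
components. [folklore] -/
theorem fderiv_apply_eq (hw : ContDiff ℝ 1 w) (z d : ℝ × EuclideanSpace ℝ (Fin 2)) (i : Fin 2) :
    fderiv ℝ w z d i = fderiv ℝ (fun z => w z i) z d := by
  have h : (fun z => w z i) =
      (EuclideanSpace.proj i : EuclideanSpace ℝ (Fin 2) →L[ℝ] ℝ) ∘ w := by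
    ext z; simp
  rw [h, fderiv_comp z (EuclideanSpace.proj i : EuclideanSpace ℝ (Fin 2) →L[ℝ] ℝ).differentiableAt
    ((hw.differentiable one_ne_zero) z), ContinuousLinearMap.fderiv]
  simp

/-- The fan integrand `q ∂ₜφ + g ∂ₓφ + f ∂_yφ` of a `C¹_c` function is integrable. [folklore] -/
theorem integrable_fanIntegrand (hφ : ContDiff ℝ 1 φ) (hφc : HasCompactSupport φ) (q g f : ℝ) :
    Integrable (fun z => q * fderiv ℝ φ z (1, 0) +
      g * fderiv ℝ φ z (0, EuclideanSpace.single 0 1) +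
      f * fderiv ℝ φ z (0, EuclideanSpace.single 1 1)) :=
  (((integrable_fderiv_apply' hφ hφc _).const_mul q).add
    ((integrable_fderiv_apply' hφ hφc _).const_mul g)).add
    ((integrable_fderiv_apply' hφ hφc _).const_mul f)

/-- The sum of the fan integrands of two `C¹_c` functions is integrable (stated for the pointwise
sum, as consumed by `integral_add`). [folklore] -/
theorem integrable_fanIntegrand_add {ψ : ℝ × EuclideanSpace ℝ (Fin 2) → ℝ} (hφ : ContDiff ℝ 1 φ)
    (hφc : HasCompactSupport φ) (hψ : ContDiff ℝ 1 ψ) (hψc : HasCompactSupport ψ)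
    (q g f q' g' f' : ℝ) :
    Integrable (fun z => (q * fderiv ℝ φ z (1, 0) +
      g * fderiv ℝ φ z (0, EuclideanSpace.single 0 1) +
      f * fderiv ℝ φ z (0, EuclideanSpace.single 1 1)) +
      (q' * fderiv ℝ ψ z (1, 0) +
      g' * fderiv ℝ ψ z (0, EuclideanSpace.single 0 1) +
      f' * fderiv ℝ ψ z (0, EuclideanSpace.single 1 1))) :=
  (integrable_fanIntegrand hφ hφc q g f).add (integrable_fanIntegrand hψ hψc q' g' f')

/-- A bounded measurable factor times a derivative of a `C¹_c` function is integrable on any set.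
[folklore] -/
theorem integrableOn_bdd_mul_fderiv {S : Set (ℝ × EuclideanSpace ℝ (Fin 2))}
    {F : ℝ × EuclideanSpace ℝ (Fin 2) → ℝ} {K : ℝ} (hF : Measurable F)
    (hbd : ∀ᵐ z ∂(volume.restrict S), |F z| ≤ K) (hφ : ContDiff ℝ 1 φ)
    (hφc : HasCompactSupport φ) (d : ℝ × EuclideanSpace ℝ (Fin 2)) :
    IntegrableOn (fun z => F z * fderiv ℝ φ z d) S :=
  (integrable_fderiv_apply' hφ hφc d).integrableOn.bdd_mul hF.aestronglyMeasurable
    (by simpa only [Real.norm_eq_abs] using hbd)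

end TestFunctions

/-! ### The fan partition up to null sets -/

section Fan

variable {σ e : ℝ} {v : ℝ × EuclideanSpace ℝ (Fin 2) → EuclideanSpace ℝ (Fin 2)}

/-- Almost every point of the half-space `{t > 0}` lies in one of the three fan regions, and on
the middle wedge the wild field has the prescribed speed. [cite: Markfelder2021, Def. 8.3.2 (fan partition)] -/
theorem ae_fan_cases (hvn : ∀ᵐ z ∂(volume.restrict Γ₁[σ]), ‖v z‖ ^ 2 = 2 * e) :
    ∀ᵐ z ∂(volume.restrict (Ioi (0 : ℝ) ×ˢ (univ : Set (EuclideanSpace ℝ (Fin 2))))),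
      z ∈ Γₘ[σ] ∨ (z ∈ Γ₁[σ] ∧ ‖v z‖ ^ 2 = 2 * e) ∨ z ∈ Γₚ[σ] := by
  have h1 : ∀ᵐ z ∂(volume : Measure (ℝ × EuclideanSpace ℝ (Fin 2))),
      z ∈ Γ₁[σ] → ‖v z‖ ^ 2 = 2 * e := ae_imp_of_ae_restrict hvn
  have h2 : ∀ᵐ z ∂(volume.restrict (Ioi (0 : ℝ) ×ˢ (univ : Set (EuclideanSpace ℝ (Fin 2))))),
      z ∈ (Γₘ[σ] ∪ Γ₁[σ]) ∪ Γₚ[σ] := by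
    rw [Measure.restrict_congr_set (halfSpace_ae_eq_fan σ)]
    exact ae_restrict_mem (((measurableSet_fanLower (-σ)).union
      (measurableSet_fanMiddle (-σ) σ)).union (measurableSet_fanUpper σ))
  filter_upwards [h2, ae_restrict_of_ae h1] with z hz h1z
  rcases hz with (h | h) | h
  exacts [Or.inl h, Or.inr (Or.inl ⟨h, h1z h⟩), Or.inr (Or.inr h)]

/-- The middle wedge is contained in the half-space `{t > 0}`. [folklore] -/
theorem fanMiddle_subset (σ : ℝ) :
    Γ₁[σ] ⊆ Ioi (0 : ℝ) ×ˢ (univ : Set (EuclideanSpace ℝ (Fin 2))) :=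
  fun _ hz => ⟨hz.1, mem_univ _⟩

/-- The middle wedge is non-empty (it contains `(1, 0)`) when `σ > 0`. [folklore] -/
theorem fanMiddle_nonempty (hσ : 0 < σ) : (Γ₁[σ]).Nonempty :=
  ⟨((1 : ℝ), (0 : EuclideanSpace ℝ (Fin 2))), by refine ⟨one_pos, ?_, ?_⟩ <;> simp [hσ]⟩

end Fan

/-! ### Gluing: the four balance laws of Definition 3.2.5 -/

section Glue

variable {γ σ a R P e g : ℝ} {ρ p : ℝ × EuclideanSpace ℝ (Fin 2) → ℝ}
  {u v : ℝ × EuclideanSpace ℝ (Fin 2) → EuclideanSpace ℝ (Fin 2)}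

/-- A.e. bounds of the glued fields on the half-space. [folklore] -/
theorem ae_glued_bounds
    (hreg : (∀ z ∈ Γₘ[σ], ρ z = 1 ∧ u z = EuclideanSpace.single 1 a ∧ p z = 1) ∧
      (∀ z ∈ Γ₁[σ], ρ z = R ∧ u z = v z ∧ p z = P) ∧
      (∀ z ∈ Γₚ[σ], ρ z = 1 ∧ u z = EuclideanSpace.single 1 (-a) ∧ p z = 1))
    (hvn : ∀ᵐ z ∂(volume.restrict Γ₁[σ]), ‖v z‖ ^ 2 = 2 * e) :
    ∀ᵐ z ∂(volume.restrict (Ioi (0 : ℝ) ×ˢ (univ : Set (EuclideanSpace ℝ (Fin 2))))),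
      |ρ z| ≤ 1 + |R| ∧ ‖u z‖ ≤ |a| + Real.sqrt (2 * e) ∧ |p z| ≤ 1 + |P| := by
  filter_upwards [ae_fan_cases hvn] with z hz
  rcases hz with hz | ⟨hz, hn⟩ | hz
  · obtain ⟨h1, h2, h3⟩ := hreg.1 z hz
    rw [h1, h2, h3]
    refine ⟨?_, ?_, ?_⟩ <;> simp [abs_nonneg]
  · obtain ⟨h1, h2, h3⟩ := hreg.2.1 z hz
    rw [h1, h2, h3]
    refine ⟨?_, ?_, ?_⟩
    · linarith [le_abs_self R]
    · rw [← hn, Real.sqrt_sq (norm_nonneg _)]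
      linarith [abs_nonneg a]
    · linarith [le_abs_self P]
  · obtain ⟨h1, h2, h3⟩ := hreg.2.2 z hz
    rw [h1, h2, h3]
    refine ⟨?_, ?_, ?_⟩ <;> simp [abs_nonneg]

/-- **Mass (3.63).** The glued fields satisfy the weak continuity equation with the Riemann datum
`ρ_init = 1`: the weak form reduces to the fan identity with density `(1, R, 1)` and `y`-flux
`(a, 0, -a)` (on `Γ₁` the flux pairing `∫ u · ∇φ` vanishes by the convex-integration lemma), whose
Rankine–Hugoniot defects `a - σ(R - 1)` vanish. [cite: Markfelder2021, Thm 8.3.4 (proof, (3.63) via (7.9)/(5.7))] -/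
theorem glued_mass (hσ : 0 < σ) (hmass : σ * (R - 1) = a)
    (hreg : (∀ z ∈ Γₘ[σ], ρ z = 1 ∧ u z = EuclideanSpace.single 1 a ∧ p z = 1) ∧
      (∀ z ∈ Γ₁[σ], ρ z = R ∧ u z = v z ∧ p z = P) ∧
      (∀ z ∈ Γₚ[σ], ρ z = 1 ∧ u z = EuclideanSpace.single 1 (-a) ∧ p z = 1))
    (hρ : Measurable ρ) (hu : Measurable u)
    (hv : IsCISolution Γ₁[σ] 0 (Matrix.diagonal ![g, -g]) (2 * e) v)
    (φ : SpaceTime → ℝ) (hφ : IsTestFunction φ) :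
    (∫ z in domain, (ρ z * dt φ z + ρ z * ∑ j, u z j * dx j φ z)) +
      ∫ x, (fun _ => (1 : ℝ)) x * φ (0, x) = 0 := by
  have hφ1 := contDiff_one_of_isTestFunction hφ
  have hφc := hφ.hasCompactSupport
  obtain ⟨hvm, hvn, hdiv, -⟩ := hv
  have hbd := ae_glued_bounds hreg hvn
  -- integrability on the half-space
  have hInt : IntegrableOn (fun z => ρ z * dt φ z + ρ z * ∑ j, u z j * dx j φ z)
      (Ioi (0 : ℝ) ×ˢ (univ : Set (EuclideanSpace ℝ (Fin 2)))) := by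
    have h1 : IntegrableOn (fun z => ρ z * dt φ z)
        (Ioi (0 : ℝ) ×ˢ (univ : Set (EuclideanSpace ℝ (Fin 2)))) :=
      integrableOn_bdd_mul_fderiv hρ (hbd.mono fun z hz => hz.1) hφ1 hφc _
    have h2 : ∀ j : Fin 2, IntegrableOn (fun z => (ρ z * u z j) * dx j φ z)
        (Ioi (0 : ℝ) ×ˢ (univ : Set (EuclideanSpace ℝ (Fin 2)))) := fun j =>
      integrableOn_bdd_mul_fderiv (F := fun z => ρ z * u z j)
        (K := (1 + |R|) * (|a| + Real.sqrt (2 * e)))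
        (hρ.mul (measurable_apply_comp hu j)) (hbd.mono fun z hz => by
          rw [abs_mul]
          exact mul_le_mul hz.1 ((abs_apply_le_norm _ _).trans hz.2.1) (abs_nonneg _)
            (by positivity)) hφ1 hφc _
    refine (h1.add (integrable_finsetSum (Finset.univ : Finset (Fin 2)) fun j _ => h2 j)).congr ?_
    refine ae_of_all _ fun z => ?_
    simp only [Pi.add_apply, Finset.mul_sum]
    ring_nf
  rw [domain, setIntegral_halfSpace_eq_fan hσ hInt]
  -- region by region
  have Hm : ∫ z in Γₘ[σ], (ρ z * dt φ z + ρ z * ∑ j, u z j * dx j φ z) =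
      ∫ z in Γₘ[σ], (1 * fderiv ℝ φ z (1, 0) + 0 * fderiv ℝ φ z (0, EuclideanSpace.single 0 1) +
        a * fderiv ℝ φ z (0, EuclideanSpace.single 1 1)) := by
    refine setIntegral_congr_fun (measurableSet_fanLower (-σ)) fun z hz => ?_
    obtain ⟨h1, h2, -⟩ := hreg.1 z hz
    simp [dt, dx, h1, h2]
  have Hp : ∫ z in Γₚ[σ], (ρ z * dt φ z + ρ z * ∑ j, u z j * dx j φ z) =
      ∫ z in Γₚ[σ], (1 * fderiv ℝ φ z (1, 0) + 0 * fderiv ℝ φ z (0, EuclideanSpace.single 0 1) +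
        (-a) * fderiv ℝ φ z (0, EuclideanSpace.single 1 1)) := by
    refine setIntegral_congr_fun (measurableSet_fanUpper σ) fun z hz => ?_
    obtain ⟨h1, h2, -⟩ := hreg.2.2 z hz
    simp [dt, dx, h1, h2]
  have hdiv0 : ∫ z in Γ₁[σ], ∑ j, v z j * fderiv ℝ φ z (0, EuclideanSpace.single j 1) = 0 := by
    simpa using hdiv φ hφ
  have hdivI : IntegrableOn
      (fun z => ∑ j, v z j * fderiv ℝ φ z (0, EuclideanSpace.single j 1)) Γ₁[σ] := by
    simpa using integrableOn_divIntegrand (v₀ := 0) hvm hvn hφ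
  have H1 : ∫ z in Γ₁[σ], (ρ z * dt φ z + ρ z * ∑ j, u z j * dx j φ z) =
      ∫ z in Γ₁[σ], (R * fderiv ℝ φ z (1, 0) + 0 * fderiv ℝ φ z (0, EuclideanSpace.single 0 1) +
        0 * fderiv ℝ φ z (0, EuclideanSpace.single 1 1)) := by
    calc ∫ z in Γ₁[σ], (ρ z * dt φ z + ρ z * ∑ j, u z j * dx j φ z)
        = ∫ z in Γ₁[σ], (R * fderiv ℝ φ z (1, 0) +
            R * ∑ j, v z j * fderiv ℝ φ z (0, EuclideanSpace.single j 1)) := by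
          refine setIntegral_congr_fun (measurableSet_fanMiddle (-σ) σ) fun z hz => ?_
          obtain ⟨h1, h2, -⟩ := hreg.2.1 z hz
          simp only [dt, dx, h1, h2]
      _ = (∫ z in Γ₁[σ], R * fderiv ℝ φ z (1, 0)) +
            R * ∫ z in Γ₁[σ], ∑ j, v z j * fderiv ℝ φ z (0, EuclideanSpace.single j 1) := by
          rw [integral_add ((integrable_fderiv_apply' hφ1 hφc _).const_mul R).integrableOn
            (hdivI.const_mul R), integral_const_mul, integral_const_mul]
      _ = ∫ z in Γ₁[σ], (R * fderiv ℝ φ z (1, 0) + 0 * fderiv ℝ φ z (0, EuclideanSpace.single 0 1) +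
            0 * fderiv ℝ φ z (0, EuclideanSpace.single 1 1)) := by
          rw [hdiv0, mul_zero, add_zero]
          refine setIntegral_congr_fun (measurableSet_fanMiddle (-σ) σ) fun z _ => ?_
          ring
  have Hi : ∫ x, (fun _ => (1 : ℝ)) x * φ (0, x) =
      ∫ x : EuclideanSpace ℝ (Fin 2), (if x 1 < 0 then (1 : ℝ) else 1) * φ (0, x) := by
    simp
  rw [Hm, H1, Hp, Hi]
  exact fan_weakForm_eq_zero hφ1 hφc hσ (by linear_combination -hmass)
    (by linear_combination -hmass)

/-- **Momentum (3.64).** The glued fields satisfy the weak momentum equation with the Riemann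
datum `ρ_init u_init = (0, ±a)`: one fan identity per component of the test function — for the
`x`-component no density, `x`-flux `(1, R(e + g) + P, 1)` (pressure plus stress) on
`(Γ₋, Γ₁, Γ₊)` and no `y`-flux; for the `y`-component density `(a, 0, -a)`, no `x`-flux and
`y`-flux `(a² + 1, R(e - g) + P, a² + 1)` — where on `Γ₁` the pairing
`∫ ρ [u · ∂ₜw + u ⊗ u : ∇w]` has been replaced by `∫ R (e Id + diag(g, -g)) : ∇w` using the
convex-integration lemma. The only non-trivial defects, `±(a² + 1 + R(g - e) - P + σa)`,
vanish by the `y`-momentum Rankine–Hugoniot condition.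
[cite: Markfelder2021, Thm 8.3.4 (proof, (3.64) via (7.10)/(5.8))] -/
theorem glued_momentum (hσ : 0 < σ) (hmom : a ^ 2 + 1 + R * (g - e) - P + σ * a = 0)
    (hreg : (∀ z ∈ Γₘ[σ], ρ z = 1 ∧ u z = EuclideanSpace.single 1 a ∧ p z = 1) ∧
      (∀ z ∈ Γ₁[σ], ρ z = R ∧ u z = v z ∧ p z = P) ∧
      (∀ z ∈ Γₚ[σ], ρ z = 1 ∧ u z = EuclideanSpace.single 1 (-a) ∧ p z = 1))
    (hρ : Measurable ρ) (hu : Measurable u) (hp : Measurable p)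
    (hv : IsCISolution Γ₁[σ] 0 (Matrix.diagonal ![g, -g]) (2 * e) v)
    (w : SpaceTime → E2) (hw : IsTestFunction w) :
    (∫ z in domain, (ρ z * ∑ i, u z i * dt w z i +
        ρ z * ∑ i, ∑ j, u z i * u z j * dx j w z i + p z * ∑ i, dx i w z i)) +
      ∫ x, (fun _ => (1 : ℝ)) x * ∑ i, collidingStreams a x i * w (0, x) i = 0 := by
  have hw1 := contDiff_one_of_isTestFunction hw
  have hW := fun i => contDiff_one_of_isTestFunction (isTestFunction_apply hw i)
  have hWc := fun i => (isTestFunction_apply hw i).hasCompactSupport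
  have hd := fderiv_apply_eq hw1
  obtain ⟨hvm, hvn, -, hmomv⟩ := hv
  have hbd := ae_glued_bounds hreg hvn
  -- integrability on the half-space
  have hInt : IntegrableOn (fun z => ρ z * ∑ i, u z i * dt w z i +
        ρ z * ∑ i, ∑ j, u z i * u z j * dx j w z i + p z * ∑ i, dx i w z i)
      (Ioi (0 : ℝ) ×ˢ (univ : Set (EuclideanSpace ℝ (Fin 2)))) := by
    have hK1 : ∀ i : Fin 2, ∀ᵐ z ∂(volume.restrict (Ioi (0 : ℝ) ×ˢ univ)),
        |ρ z * u z i| ≤ (1 + |R|) * (|a| + Real.sqrt (2 * e)) := fun i =>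
      hbd.mono fun z hz => by
        rw [abs_mul]
        exact mul_le_mul hz.1 ((abs_apply_le_norm _ _).trans hz.2.1) (abs_nonneg _)
          (by positivity)
    have hK2 : ∀ i j : Fin 2, ∀ᵐ z ∂(volume.restrict (Ioi (0 : ℝ) ×ˢ univ)),
        |ρ z * (u z i * u z j)| ≤ (1 + |R|) * ((|a| + Real.sqrt (2 * e)) *
          (|a| + Real.sqrt (2 * e))) := fun i j =>
      hbd.mono fun z hz => by
        rw [abs_mul, abs_mul]
        refine mul_le_mul hz.1 (mul_le_mul ((abs_apply_le_norm _ _).trans hz.2.1)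
          ((abs_apply_le_norm _ _).trans hz.2.1) (abs_nonneg _) (by positivity))
          (by positivity) (by positivity)
    have h1 : ∀ i : Fin 2, IntegrableOn (fun z => (ρ z * u z i) * fderiv ℝ (fun z => w z i) z (1, 0))
        (Ioi (0 : ℝ) ×ˢ (univ : Set (EuclideanSpace ℝ (Fin 2)))) := fun i =>
      integrableOn_bdd_mul_fderiv (F := fun z => ρ z * u z i)
        (hρ.mul (measurable_apply_comp hu i)) (hK1 i) (hW i) (hWc i) _
    have h2 : ∀ i j : Fin 2, IntegrableOn
        (fun z => (ρ z * (u z i * u z j)) *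
          fderiv ℝ (fun z => w z i) z (0, EuclideanSpace.single j 1))
        (Ioi (0 : ℝ) ×ˢ (univ : Set (EuclideanSpace ℝ (Fin 2)))) := fun i j =>
      integrableOn_bdd_mul_fderiv (F := fun z => ρ z * (u z i * u z j))
        (hρ.mul ((measurable_apply_comp hu i).mul (measurable_apply_comp hu j))) (hK2 i j)
        (hW i) (hWc i) _
    have h3 : ∀ i : Fin 2, IntegrableOn
        (fun z => p z * fderiv ℝ (fun z => w z i) z (0, EuclideanSpace.single i 1))
        (Ioi (0 : ℝ) ×ˢ (univ : Set (EuclideanSpace ℝ (Fin 2)))) := fun i =>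
      integrableOn_bdd_mul_fderiv hp (hbd.mono fun z hz => hz.2.2) (hW i) (hWc i) _
    have h12 := (integrable_finsetSum (Finset.univ : Finset (Fin 2)) fun i _ => h1 i).add
      (integrable_finsetSum (Finset.univ : Finset (Fin 2)) fun i _ =>
        integrable_finsetSum (Finset.univ : Finset (Fin 2)) fun j _ => h2 i j)
    refine (h12.add (integrable_finsetSum (Finset.univ : Finset (Fin 2)) fun i _ => h3 i)).congr
      (ae_of_all _ fun z => ?_)
    simp only [Pi.add_apply, dt, dx, hd, Finset.mul_sum]
    ring_nf
  rw [domain, setIntegral_halfSpace_eq_fan hσ hInt]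
  -- outer regions: componentwise fan integrands
  have Hm : ∫ z in Γₘ[σ], (ρ z * ∑ i, u z i * dt w z i +
        ρ z * ∑ i, ∑ j, u z i * u z j * dx j w z i + p z * ∑ i, dx i w z i) =
      (∫ z in Γₘ[σ], (0 * fderiv ℝ (fun z => w z 0) z (1, 0) +
        1 * fderiv ℝ (fun z => w z 0) z (0, EuclideanSpace.single 0 1) +
        0 * fderiv ℝ (fun z => w z 0) z (0, EuclideanSpace.single 1 1))) +
      ∫ z in Γₘ[σ], (a * fderiv ℝ (fun z => w z 1) z (1, 0) +
        0 * fderiv ℝ (fun z => w z 1) z (0, EuclideanSpace.single 0 1) +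
        (a ^ 2 + 1) * fderiv ℝ (fun z => w z 1) z (0, EuclideanSpace.single 1 1)) := by
    rw [← integral_add (integrable_fanIntegrand (hW 0) (hWc 0) _ _ _).integrableOn
      (integrable_fanIntegrand (hW 1) (hWc 1) _ _ _).integrableOn]
    refine setIntegral_congr_fun (measurableSet_fanLower (-σ)) fun z hz => ?_
    obtain ⟨h1, h2, h3⟩ := hreg.1 z hz
    simp only [dt, dx, h1, h2, h3, hd, Fin.sum_univ_two]
    simp
    ring
  have Hp : ∫ z in Γₚ[σ], (ρ z * ∑ i, u z i * dt w z i +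
        ρ z * ∑ i, ∑ j, u z i * u z j * dx j w z i + p z * ∑ i, dx i w z i) =
      (∫ z in Γₚ[σ], (0 * fderiv ℝ (fun z => w z 0) z (1, 0) +
        1 * fderiv ℝ (fun z => w z 0) z (0, EuclideanSpace.single 0 1) +
        0 * fderiv ℝ (fun z => w z 0) z (0, EuclideanSpace.single 1 1))) +
      ∫ z in Γₚ[σ], ((-a) * fderiv ℝ (fun z => w z 1) z (1, 0) +
        0 * fderiv ℝ (fun z => w z 1) z (0, EuclideanSpace.single 0 1) +
        (a ^ 2 + 1) * fderiv ℝ (fun z => w z 1) z (0, EuclideanSpace.single 1 1)) := by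
    rw [← integral_add (integrable_fanIntegrand (hW 0) (hWc 0) _ _ _).integrableOn
      (integrable_fanIntegrand (hW 1) (hWc 1) _ _ _).integrableOn]
    refine setIntegral_congr_fun (measurableSet_fanUpper σ) fun z hz => ?_
    obtain ⟨h1, h2, h3⟩ := hreg.2.2 z hz
    simp only [dt, dx, h1, h2, h3, hd, Fin.sum_univ_two]
    simp
    ring
  -- middle wedge: the convex-integration identity
  have hmom0 := hmomv w hw
  have hmomI := integrableOn_momIntegrand (v₀ := 0) (u₀ := Matrix.diagonal ![g, -g])
    (C := 2 * e) hvm hvn hw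
  have H1 : ∫ z in Γ₁[σ], (ρ z * ∑ i, u z i * dt w z i +
        ρ z * ∑ i, ∑ j, u z i * u z j * dx j w z i + p z * ∑ i, dx i w z i) =
      (∫ z in Γ₁[σ], (0 * fderiv ℝ (fun z => w z 0) z (1, 0) +
        (R * (e + g) + P) * fderiv ℝ (fun z => w z 0) z (0, EuclideanSpace.single 0 1) +
        0 * fderiv ℝ (fun z => w z 0) z (0, EuclideanSpace.single 1 1))) +
      ∫ z in Γ₁[σ], (0 * fderiv ℝ (fun z => w z 1) z (1, 0) +
        0 * fderiv ℝ (fun z => w z 1) z (0, EuclideanSpace.single 0 1) +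
        (R * (e - g) + P) * fderiv ℝ (fun z => w z 1) z (0, EuclideanSpace.single 1 1)) := by
    calc ∫ z in Γ₁[σ], (ρ z * ∑ i, u z i * dt w z i +
          ρ z * ∑ i, ∑ j, u z i * u z j * dx j w z i + p z * ∑ i, dx i w z i)
        = ∫ z in Γ₁[σ], (R * (∑ i, (v z i - (0 : EuclideanSpace ℝ (Fin 2)) i) *
              fderiv ℝ w z (1, 0) i +
            ∑ i, ∑ j, (v z i * v z j - (if i = j then 2 * e / 2 else 0) -
              Matrix.diagonal ![g, -g] i j) * fderiv ℝ w z (0, EuclideanSpace.single j 1) i) +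
          ((0 * fderiv ℝ (fun z => w z 0) z (1, 0) +
            (R * (e + g) + P) * fderiv ℝ (fun z => w z 0) z (0, EuclideanSpace.single 0 1) +
            0 * fderiv ℝ (fun z => w z 0) z (0, EuclideanSpace.single 1 1)) +
          (0 * fderiv ℝ (fun z => w z 1) z (1, 0) +
            0 * fderiv ℝ (fun z => w z 1) z (0, EuclideanSpace.single 0 1) +
            (R * (e - g) + P) * fderiv ℝ (fun z => w z 1) z (0, EuclideanSpace.single 1 1)))) := by
          refine setIntegral_congr_fun (measurableSet_fanMiddle (-σ) σ) fun z hz => ?_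
          obtain ⟨h1, h2, h3⟩ := hreg.2.1 z hz
          simp only [dt, dx, h1, h2, h3, hd, Fin.sum_univ_two, Matrix.diagonal_apply_eq,
            Matrix.cons_val_zero, Matrix.cons_val_one]
          simp
          ring
      _ = R * (∫ z in Γ₁[σ], (∑ i, (v z i - (0 : EuclideanSpace ℝ (Fin 2)) i) *
              fderiv ℝ w z (1, 0) i +
            ∑ i, ∑ j, (v z i * v z j - (if i = j then 2 * e / 2 else 0) -
              Matrix.diagonal ![g, -g] i j) * fderiv ℝ w z (0, EuclideanSpace.single j 1) i)) +
          ((∫ z in Γ₁[σ], (0 * fderiv ℝ (fun z => w z 0) z (1, 0) +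
            (R * (e + g) + P) * fderiv ℝ (fun z => w z 0) z (0, EuclideanSpace.single 0 1) +
            0 * fderiv ℝ (fun z => w z 0) z (0, EuclideanSpace.single 1 1))) +
          ∫ z in Γ₁[σ], (0 * fderiv ℝ (fun z => w z 1) z (1, 0) +
            0 * fderiv ℝ (fun z => w z 1) z (0, EuclideanSpace.single 0 1) +
            (R * (e - g) + P) * fderiv ℝ (fun z => w z 1) z (0, EuclideanSpace.single 1 1))) := by
          rw [integral_add (hmomI.const_mul R)
              (integrable_fanIntegrand_add (hW 0) (hWc 0) (hW 1) (hWc 1) _ _ _ _ _ _).integrableOn,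
            integral_const_mul,
            integral_add (integrable_fanIntegrand (hW 0) (hWc 0) _ _ _).integrableOn
              (integrable_fanIntegrand (hW 1) (hWc 1) _ _ _).integrableOn]
      _ = _ := by rw [hmom0, mul_zero, zero_add]
  -- the initial datum, componentwise
  have Hi : ∫ x, (fun _ => (1 : ℝ)) x * ∑ i, collidingStreams a x i * w (0, x) i =
      (∫ x : EuclideanSpace ℝ (Fin 2), (if x 1 < 0 then (0 : ℝ) else 0) * w (0, x) 0) +
        ∫ x : EuclideanSpace ℝ (Fin 2), (if x 1 < 0 then a else -a) * w (0, x) 1 := by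
    have h0 : ∫ x : EuclideanSpace ℝ (Fin 2), (if x 1 < 0 then (0 : ℝ) else 0) * w (0, x) 0 = 0 := by
      simp
    rw [h0, zero_add]
    refine integral_congr_ae (ae_of_all _ fun x => ?_)
    simp only [collidingStreams, Fin.sum_univ_two, one_mul]
    split_ifs <;> simp
  rw [Hm, H1, Hp, Hi]
  have F0 := fan_weakForm_eq_zero (φ := fun z => w z 0) (hW 0) (hWc 0) hσ
    (qm := 0) (gm := 1) (fm := 0) (q₁ := 0) (g₁ := R * (e + g) + P) (f₁ := 0)
    (qp := 0) (gp := 1) (fp := 0) (by ring) (by ring)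
  have F1 := fan_weakForm_eq_zero (φ := fun z => w z 1) (hW 1) (hWc 1) hσ
    (qm := a) (gm := 0) (fm := a ^ 2 + 1) (q₁ := 0) (g₁ := 0) (f₁ := R * (e - g) + P)
    (qp := -a) (gp := 0) (fp := a ^ 2 + 1)
    (by linear_combination hmom) (by linear_combination -hmom)
  linear_combination F0 + F1

/-- **Energy (3.65).** The glued fields satisfy the weak energy equation: the total energy is
the constant `E₀ = a²/2 + 1/(γ-1)` on `Γ±` and (a.e., by `|u|² = 2e`) the constant
`E₁ = R e + P/(γ-1)` on `Γ₁`, where the flux pairing vanishes; the defects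
`(E₀ + 1)a + σ(E₀ - E₁)` vanish by the energy Rankine–Hugoniot condition.
[cite: Markfelder2021, Thm 8.3.4 (proof, (3.65) via (8.14), (8.18))] -/
theorem glued_energy (hσ : 0 < σ) (hγ : 1 < γ) (hR : 1 < R)
    (hen : a * (a ^ 2 / 2 + γ / (γ - 1)) +
      σ * (a ^ 2 / 2 + 1 / (γ - 1) - (R * e + P / (γ - 1))) = 0)
    (hreg : (∀ z ∈ Γₘ[σ], ρ z = 1 ∧ u z = EuclideanSpace.single 1 a ∧ p z = 1) ∧
      (∀ z ∈ Γ₁[σ], ρ z = R ∧ u z = v z ∧ p z = P) ∧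
      (∀ z ∈ Γₚ[σ], ρ z = 1 ∧ u z = EuclideanSpace.single 1 (-a) ∧ p z = 1))
    (hρ : Measurable ρ) (hu : Measurable u) (hp : Measurable p)
    (hv : IsCISolution Γ₁[σ] 0 (Matrix.diagonal ![g, -g]) (2 * e) v)
    (ψ : SpaceTime → ℝ) (hψ : IsTestFunction ψ) :
    (∫ z in domain, (totalEnergy γ (ρ z) (u z) (p z) * dt ψ z +
        (totalEnergy γ (ρ z) (u z) (p z) + p z) * ∑ j, u z j * dx j ψ z)) +
      ∫ x, totalEnergy γ ((fun _ => (1 : ℝ)) x) (collidingStreams a x) ((fun _ => (1 : ℝ)) x) *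
        ψ (0, x) = 0 := by
  have hψ1 := contDiff_one_of_isTestFunction hψ
  have hψc := hψ.hasCompactSupport
  obtain ⟨hvm, hvn, hdiv, -⟩ := hv
  have hbd := ae_glued_bounds hreg hvn
  have hγ0 : γ - 1 ≠ 0 := by linarith
  have hR0 : R ≠ 0 := by linarith
  -- the two energy levels
  have hE0 : totalEnergy γ 1 (EuclideanSpace.single 1 a) 1 = a ^ 2 / 2 + 1 / (γ - 1) := by
    simp [totalEnergy, internalEnergy, sq_abs]
  have hE0' : totalEnergy γ 1 (EuclideanSpace.single 1 (-a)) 1 = a ^ 2 / 2 + 1 / (γ - 1) := by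
    simp [totalEnergy, internalEnergy, sq_abs]
  have hE1 : ∀ z, ‖v z‖ ^ 2 = 2 * e → totalEnergy γ R (v z) P = R * e + P / (γ - 1) := by
    intro z hz
    simp only [totalEnergy, internalEnergy, hz]
    field_simp
  -- a.e. values and bound of the energy on the half-space
  have hEae : ∀ᵐ z ∂(volume.restrict (Ioi (0 : ℝ) ×ˢ (univ : Set (EuclideanSpace ℝ (Fin 2))))),
      |totalEnergy γ (ρ z) (u z) (p z)| ≤
        |a ^ 2 / 2 + 1 / (γ - 1)| + |R * e + P / (γ - 1)| := by
    filter_upwards [ae_fan_cases hvn] with z hz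
    rcases hz with hz | ⟨hz, hn⟩ | hz
    · obtain ⟨h1, h2, h3⟩ := hreg.1 z hz
      rw [h1, h2, h3, hE0]; linarith [abs_nonneg (R * e + P / (γ - 1))]
    · obtain ⟨h1, h2, h3⟩ := hreg.2.1 z hz
      rw [h1, h2, h3, hE1 z hn]; linarith [abs_nonneg (a ^ 2 / 2 + 1 / (γ - 1))]
    · obtain ⟨h1, h2, h3⟩ := hreg.2.2 z hz
      rw [h1, h2, h3, hE0']; linarith [abs_nonneg (R * e + P / (γ - 1))]
  have hEm : Measurable fun z => totalEnergy γ (ρ z) (u z) (p z) := by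
    unfold totalEnergy internalEnergy
    fun_prop
  -- integrability
  have hInt : IntegrableOn (fun z => totalEnergy γ (ρ z) (u z) (p z) * dt ψ z +
        (totalEnergy γ (ρ z) (u z) (p z) + p z) * ∑ j, u z j * dx j ψ z)
      (Ioi (0 : ℝ) ×ˢ (univ : Set (EuclideanSpace ℝ (Fin 2)))) := by
    have h1 : IntegrableOn (fun z => totalEnergy γ (ρ z) (u z) (p z) * dt ψ z)
        (Ioi (0 : ℝ) ×ˢ (univ : Set (EuclideanSpace ℝ (Fin 2)))) :=
      integrableOn_bdd_mul_fderiv hEm hEae hψ1 hψc _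
    have h2 : ∀ j : Fin 2, IntegrableOn
        (fun z => ((totalEnergy γ (ρ z) (u z) (p z) + p z) * u z j) * dx j ψ z)
        (Ioi (0 : ℝ) ×ˢ (univ : Set (EuclideanSpace ℝ (Fin 2)))) := fun j =>
      integrableOn_bdd_mul_fderiv (F := fun z => (totalEnergy γ (ρ z) (u z) (p z) + p z) * u z j)
        (K := (|a ^ 2 / 2 + 1 / (γ - 1)| + |R * e + P / (γ - 1)| + (1 + |P|)) *
          (|a| + Real.sqrt (2 * e)))
        ((hEm.add hp).mul (measurable_apply_comp hu j))
        ((hEae.and hbd).mono fun z hz => by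
          rw [abs_mul]
          refine mul_le_mul ((abs_add_le _ _).trans (add_le_add hz.1 hz.2.2.2))
            ((abs_apply_le_norm _ _).trans hz.2.2.1) (abs_nonneg _) (by positivity))
        hψ1 hψc _
    refine (h1.add (integrable_finsetSum (Finset.univ : Finset (Fin 2)) fun j _ => h2 j)).congr
      (ae_of_all _ fun z => ?_)
    simp only [Pi.add_apply, Finset.mul_sum]
    ring_nf
  rw [domain, setIntegral_halfSpace_eq_fan hσ hInt]
  have Hm : ∫ z in Γₘ[σ], (totalEnergy γ (ρ z) (u z) (p z) * dt ψ z +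
        (totalEnergy γ (ρ z) (u z) (p z) + p z) * ∑ j, u z j * dx j ψ z) =
      ∫ z in Γₘ[σ], ((a ^ 2 / 2 + 1 / (γ - 1)) * fderiv ℝ ψ z (1, 0) +
        0 * fderiv ℝ ψ z (0, EuclideanSpace.single 0 1) +
        ((a ^ 2 / 2 + 1 / (γ - 1) + 1) * a) * fderiv ℝ ψ z (0, EuclideanSpace.single 1 1)) := by
    refine setIntegral_congr_fun (measurableSet_fanLower (-σ)) fun z hz => ?_
    obtain ⟨h1, h2, h3⟩ := hreg.1 z hz
    simp only [dt, dx, h1, h2, h3, hE0, Fin.sum_univ_two]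
    simp
    ring
  have Hp : ∫ z in Γₚ[σ], (totalEnergy γ (ρ z) (u z) (p z) * dt ψ z +
        (totalEnergy γ (ρ z) (u z) (p z) + p z) * ∑ j, u z j * dx j ψ z) =
      ∫ z in Γₚ[σ], ((a ^ 2 / 2 + 1 / (γ - 1)) * fderiv ℝ ψ z (1, 0) +
        0 * fderiv ℝ ψ z (0, EuclideanSpace.single 0 1) +
        (-((a ^ 2 / 2 + 1 / (γ - 1) + 1) * a)) * fderiv ℝ ψ z (0, EuclideanSpace.single 1 1)) := by
    refine setIntegral_congr_fun (measurableSet_fanUpper σ) fun z hz => ?_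
    obtain ⟨h1, h2, h3⟩ := hreg.2.2 z hz
    simp only [dt, dx, h1, h2, h3, hE0', Fin.sum_univ_two]
    simp
    ring
  have hdiv0 : ∫ z in Γ₁[σ], ∑ j, v z j * fderiv ℝ ψ z (0, EuclideanSpace.single j 1) = 0 := by
    simpa using hdiv ψ hψ
  have hdivI : IntegrableOn
      (fun z => ∑ j, v z j * fderiv ℝ ψ z (0, EuclideanSpace.single j 1)) Γ₁[σ] := by
    simpa using integrableOn_divIntegrand (v₀ := 0) hvm hvn hψ
  have H1 : ∫ z in Γ₁[σ], (totalEnergy γ (ρ z) (u z) (p z) * dt ψ z +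
        (totalEnergy γ (ρ z) (u z) (p z) + p z) * ∑ j, u z j * dx j ψ z) =
      ∫ z in Γ₁[σ], ((R * e + P / (γ - 1)) * fderiv ℝ ψ z (1, 0) +
        0 * fderiv ℝ ψ z (0, EuclideanSpace.single 0 1) +
        0 * fderiv ℝ ψ z (0, EuclideanSpace.single 1 1)) := by
    calc ∫ z in Γ₁[σ], (totalEnergy γ (ρ z) (u z) (p z) * dt ψ z +
          (totalEnergy γ (ρ z) (u z) (p z) + p z) * ∑ j, u z j * dx j ψ z)
        = ∫ z in Γ₁[σ], ((R * e + P / (γ - 1)) * fderiv ℝ ψ z (1, 0) +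
            (R * e + P / (γ - 1) + P) *
              ∑ j, v z j * fderiv ℝ ψ z (0, EuclideanSpace.single j 1)) := by
          refine integral_congr_ae ?_
          filter_upwards [ae_restrict_mem (measurableSet_fanMiddle (-σ) σ), hvn] with z hz hn
          obtain ⟨h1, h2, h3⟩ := hreg.2.1 z hz
          simp only [dt, dx, h1, h2, h3, hE1 z hn]
      _ = (∫ z in Γ₁[σ], (R * e + P / (γ - 1)) * fderiv ℝ ψ z (1, 0)) +
            (R * e + P / (γ - 1) + P) *
              ∫ z in Γ₁[σ], ∑ j, v z j * fderiv ℝ ψ z (0, EuclideanSpace.single j 1) := by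
          rw [integral_add ((integrable_fderiv_apply' hψ1 hψc _).const_mul _).integrableOn
            (hdivI.const_mul _), integral_const_mul, integral_const_mul]
      _ = _ := by
          rw [hdiv0, mul_zero, add_zero]
          refine setIntegral_congr_fun (measurableSet_fanMiddle (-σ) σ) fun z _ => ?_
          ring
  have Hi : ∫ x, totalEnergy γ ((fun _ => (1 : ℝ)) x) (collidingStreams a x)
        ((fun _ => (1 : ℝ)) x) * ψ (0, x) =
      ∫ x : EuclideanSpace ℝ (Fin 2), (if x 1 < 0 then a ^ 2 / 2 + 1 / (γ - 1)
        else a ^ 2 / 2 + 1 / (γ - 1)) * ψ (0, x) := by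
    refine integral_congr_ae (ae_of_all _ fun x => ?_)
    simp only [collidingStreams]
    split_ifs with h
    · rw [hE0]
    · rw [hE0']
  rw [Hm, H1, Hp, Hi]
  have key : (a ^ 2 / 2 + 1 / (γ - 1) + 1) * a +
      σ * (a ^ 2 / 2 + 1 / (γ - 1) - (R * e + P / (γ - 1))) = 0 := by
    have h1 : (a ^ 2 / 2 + 1 / (γ - 1) + 1) * a = a * (a ^ 2 / 2 + γ / (γ - 1)) := by
      field_simp
      ring
    rw [h1]
    exact hen
  exact fan_weakForm_eq_zero hψ1 hψc hσ (by linear_combination key) (by linear_combination key)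

/-- **Entropy inequalities (3.66).** For every smooth non-decreasing `Z` and non-negative test
function, the glued fields satisfy the entropy inequality: the specific entropy is `0` on `Γ±`
and `s₁ = (log P - γ log R)/(γ - 1) ≥ 0` on `Γ₁`, the flux pairing on `Γ₁` vanishes, and the
defects are `σ R (Z(0) - Z(s₁)) ≤ 0`. [cite: Markfelder2021, Thm 8.3.4 (proof, (3.66) via (8.15), (8.18)) and Prop. 8.3.5 ((8.42)–(8.45))] -/
theorem glued_entropy (hσ : 0 < σ) (hγ : 1 < γ) (hR : 1 < R)
    (hmass : σ * (R - 1) = a) (hent : γ * Real.log R ≤ Real.log P)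
    (hreg : (∀ z ∈ Γₘ[σ], ρ z = 1 ∧ u z = EuclideanSpace.single 1 a ∧ p z = 1) ∧
      (∀ z ∈ Γ₁[σ], ρ z = R ∧ u z = v z ∧ p z = P) ∧
      (∀ z ∈ Γₚ[σ], ρ z = 1 ∧ u z = EuclideanSpace.single 1 (-a) ∧ p z = 1))
    (hρ : Measurable ρ) (hu : Measurable u) (hp : Measurable p)
    (hv : IsCISolution Γ₁[σ] 0 (Matrix.diagonal ![g, -g]) (2 * e) v)
    (Z : ℝ → ℝ) (hZ : ContDiff ℝ (⊤ : ℕ∞) Z) (hZ' : ∀ r, 0 ≤ deriv Z r)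
    (φ : SpaceTime → ℝ) (hφ : IsTestFunction φ) (hφ0 : ∀ z, 0 ≤ φ z) :
    (∫ z in domain, (ρ z * Z (specificEntropy γ (ρ z) (p z)) * dt φ z +
        ρ z * Z (specificEntropy γ (ρ z) (p z)) * ∑ j, u z j * dx j φ z)) +
      ∫ x, (fun _ => (1 : ℝ)) x * Z (specificEntropy γ ((fun _ => (1 : ℝ)) x)
        ((fun _ => (1 : ℝ)) x)) * φ (0, x) ≤ 0 := by
  have hφ1 := contDiff_one_of_isTestFunction hφ
  have hφc := hφ.hasCompactSupport
  obtain ⟨hvm, hvn, hdiv, -⟩ := hv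
  have hbd := ae_glued_bounds hreg hvn
  have hZmono : Monotone Z := monotone_of_deriv_nonneg (hZ.differentiable (by simp)) hZ'
  have hs0 : specificEntropy γ 1 1 = 0 := by simp [specificEntropy]
  set s₁ : ℝ := specificEntropy γ R P with hs₁
  have hs₁0 : 0 ≤ s₁ := div_nonneg (by linarith) (by linarith)
  have hZle : Z 0 ≤ Z s₁ := hZmono hs₁0
  -- measurability and a.e. bound of `ρ Z(s)`
  have hSm : Measurable fun z => ρ z * Z (specificEntropy γ (ρ z) (p z)) := by
    have hZc := hZ.continuous
    unfold specificEntropy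
    fun_prop
  have hSae : ∀ᵐ z ∂(volume.restrict (Ioi (0 : ℝ) ×ˢ (univ : Set (EuclideanSpace ℝ (Fin 2))))),
      |ρ z * Z (specificEntropy γ (ρ z) (p z))| ≤ |Z 0| + |R * Z s₁| := by
    filter_upwards [ae_fan_cases hvn] with z hz
    rcases hz with hz | ⟨hz, -⟩ | hz
    · obtain ⟨h1, -, h3⟩ := hreg.1 z hz
      rw [h1, h3, hs0, one_mul]; linarith [abs_nonneg (R * Z s₁)]
    · obtain ⟨h1, -, h3⟩ := hreg.2.1 z hz
      rw [h1, h3]; linarith [abs_nonneg (Z 0)]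
    · obtain ⟨h1, -, h3⟩ := hreg.2.2 z hz
      rw [h1, h3, hs0, one_mul]; linarith [abs_nonneg (R * Z s₁)]
  have hInt : IntegrableOn (fun z => ρ z * Z (specificEntropy γ (ρ z) (p z)) * dt φ z +
        ρ z * Z (specificEntropy γ (ρ z) (p z)) * ∑ j, u z j * dx j φ z)
      (Ioi (0 : ℝ) ×ˢ (univ : Set (EuclideanSpace ℝ (Fin 2)))) := by
    have h1 : IntegrableOn (fun z => ρ z * Z (specificEntropy γ (ρ z) (p z)) * dt φ z)
        (Ioi (0 : ℝ) ×ˢ (univ : Set (EuclideanSpace ℝ (Fin 2)))) :=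
      integrableOn_bdd_mul_fderiv hSm hSae hφ1 hφc _
    have h2 : ∀ j : Fin 2, IntegrableOn
        (fun z => (ρ z * Z (specificEntropy γ (ρ z) (p z)) * u z j) * dx j φ z)
        (Ioi (0 : ℝ) ×ˢ (univ : Set (EuclideanSpace ℝ (Fin 2)))) := fun j =>
      integrableOn_bdd_mul_fderiv (F := fun z => ρ z * Z (specificEntropy γ (ρ z) (p z)) * u z j)
        (K := (|Z 0| + |R * Z s₁|) * (|a| + Real.sqrt (2 * e)))
        (hSm.mul (measurable_apply_comp hu j))
        ((hSae.and hbd).mono fun z hz => by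
          rw [abs_mul]
          exact mul_le_mul hz.1 ((abs_apply_le_norm _ _).trans hz.2.2.1) (abs_nonneg _)
            (by positivity))
        hφ1 hφc _
    refine (h1.add (integrable_finsetSum (Finset.univ : Finset (Fin 2)) fun j _ => h2 j)).congr
      (ae_of_all _ fun z => ?_)
    simp only [Pi.add_apply, Finset.mul_sum]
    ring_nf
  rw [domain, setIntegral_halfSpace_eq_fan hσ hInt]
  have Hm : ∫ z in Γₘ[σ], (ρ z * Z (specificEntropy γ (ρ z) (p z)) * dt φ z +
        ρ z * Z (specificEntropy γ (ρ z) (p z)) * ∑ j, u z j * dx j φ z) =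
      ∫ z in Γₘ[σ], (Z 0 * fderiv ℝ φ z (1, 0) +
        0 * fderiv ℝ φ z (0, EuclideanSpace.single 0 1) +
        (Z 0 * a) * fderiv ℝ φ z (0, EuclideanSpace.single 1 1)) := by
    refine setIntegral_congr_fun (measurableSet_fanLower (-σ)) fun z hz => ?_
    obtain ⟨h1, h2, h3⟩ := hreg.1 z hz
    simp only [dt, dx, h1, h2, h3, hs0, Fin.sum_univ_two]
    simp
    ring
  have Hp : ∫ z in Γₚ[σ], (ρ z * Z (specificEntropy γ (ρ z) (p z)) * dt φ z +
        ρ z * Z (specificEntropy γ (ρ z) (p z)) * ∑ j, u z j * dx j φ z) =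
      ∫ z in Γₚ[σ], (Z 0 * fderiv ℝ φ z (1, 0) +
        0 * fderiv ℝ φ z (0, EuclideanSpace.single 0 1) +
        (-(Z 0 * a)) * fderiv ℝ φ z (0, EuclideanSpace.single 1 1)) := by
    refine setIntegral_congr_fun (measurableSet_fanUpper σ) fun z hz => ?_
    obtain ⟨h1, h2, h3⟩ := hreg.2.2 z hz
    simp only [dt, dx, h1, h2, h3, hs0, Fin.sum_univ_two]
    simp
    ring
  have hdiv0 : ∫ z in Γ₁[σ], ∑ j, v z j * fderiv ℝ φ z (0, EuclideanSpace.single j 1) = 0 := by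
    simpa using hdiv φ hφ
  have hdivI : IntegrableOn
      (fun z => ∑ j, v z j * fderiv ℝ φ z (0, EuclideanSpace.single j 1)) Γ₁[σ] := by
    simpa using integrableOn_divIntegrand (v₀ := 0) hvm hvn hφ
  have H1 : ∫ z in Γ₁[σ], (ρ z * Z (specificEntropy γ (ρ z) (p z)) * dt φ z +
        ρ z * Z (specificEntropy γ (ρ z) (p z)) * ∑ j, u z j * dx j φ z) =
      ∫ z in Γ₁[σ], ((R * Z s₁) * fderiv ℝ φ z (1, 0) +
        0 * fderiv ℝ φ z (0, EuclideanSpace.single 0 1) +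
        0 * fderiv ℝ φ z (0, EuclideanSpace.single 1 1)) := by
    calc ∫ z in Γ₁[σ], (ρ z * Z (specificEntropy γ (ρ z) (p z)) * dt φ z +
          ρ z * Z (specificEntropy γ (ρ z) (p z)) * ∑ j, u z j * dx j φ z)
        = ∫ z in Γ₁[σ], ((R * Z s₁) * fderiv ℝ φ z (1, 0) +
            (R * Z s₁) * ∑ j, v z j * fderiv ℝ φ z (0, EuclideanSpace.single j 1)) := by
          refine setIntegral_congr_fun (measurableSet_fanMiddle (-σ) σ) fun z hz => ?_
          obtain ⟨h1, h2, h3⟩ := hreg.2.1 z hz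
          simp only [dt, dx, h1, h2, h3, hs₁]
      _ = (∫ z in Γ₁[σ], (R * Z s₁) * fderiv ℝ φ z (1, 0)) +
            (R * Z s₁) * ∫ z in Γ₁[σ], ∑ j, v z j * fderiv ℝ φ z (0, EuclideanSpace.single j 1) := by
          rw [integral_add ((integrable_fderiv_apply' hφ1 hφc _).const_mul _).integrableOn
            (hdivI.const_mul _), integral_const_mul, integral_const_mul]
      _ = _ := by
          rw [hdiv0, mul_zero, add_zero]
          refine setIntegral_congr_fun (measurableSet_fanMiddle (-σ) σ) fun z _ => ?_
          ring
  have Hi : ∫ x, (fun _ => (1 : ℝ)) x * Z (specificEntropy γ ((fun _ => (1 : ℝ)) x)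
        ((fun _ => (1 : ℝ)) x)) * φ (0, x) =
      ∫ x : EuclideanSpace ℝ (Fin 2), (if x 1 < 0 then Z 0 else Z 0) * φ (0, x) := by
    refine integral_congr_ae (ae_of_all _ fun x => ?_)
    simp [hs0]
  rw [Hm, H1, Hp, Hi]
  have hσR : 0 < σ * R := mul_pos hσ (by linarith)
  have key : Z 0 * a + σ * (Z 0 - R * Z s₁) ≤ 0 := by
    have : Z 0 * a + σ * (Z 0 - R * Z s₁) = σ * R * (Z 0 - Z s₁) := by
      rw [← hmass]; ring
    rw [this]
    exact mul_nonpos_of_nonneg_of_nonpos hσR.le (by linarith)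
  exact fan_weakForm_nonpos hφ1 hφc hφ0 hσ (by linarith) (by linarith)

/-- **Markfelder's Theorem 8.3.4 for the symmetric fan.** Fields that equal the outer Riemann
states on `Γ±` and `(R, v, P)` on the middle wedge, with `v` a wild field of the
convex-integration lemma on `Γ₁` for `(v₀, u₀, C) = (0, diag(g, -g), 2e)` and `(R, P, σ, e, g)`
the parameters of a symmetric admissible fan subsolution, form an admissible weak solution of
the full Euler system (Definition 3.2.5) with the colliding Riemann data.
[cite: Markfelder2021, Thm 8.3.4 with Prop. 8.3.5] -/
theorem isAdmissibleWeakSolution_glued (hσ : 0 < σ) (hγ : 1 < γ) (hR : 1 < R)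
    (hmass : σ * (R - 1) = a) (hmom : a ^ 2 + 1 + R * (g - e) - P + σ * a = 0)
    (hen : a * (a ^ 2 / 2 + γ / (γ - 1)) +
      σ * (a ^ 2 / 2 + 1 / (γ - 1) - (R * e + P / (γ - 1))) = 0)
    (hent : γ * Real.log R ≤ Real.log P)
    (hreg : (∀ z ∈ Γₘ[σ], ρ z = 1 ∧ u z = EuclideanSpace.single 1 a ∧ p z = 1) ∧
      (∀ z ∈ Γ₁[σ], ρ z = R ∧ u z = v z ∧ p z = P) ∧
      (∀ z ∈ Γₚ[σ], ρ z = 1 ∧ u z = EuclideanSpace.single 1 (-a) ∧ p z = 1))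
    (hρ : Measurable ρ) (hu : Measurable u) (hp : Measurable p)
    (hpos : ∀ z, 0 < ρ z ∧ 0 < p z)
    (hv : IsCISolution Γ₁[σ] 0 (Matrix.diagonal ![g, -g]) (2 * e) v) :
    IsAdmissibleWeakSolution γ (fun _ => 1) (collidingStreams a) (fun _ => 1) ρ u p where
  measurable_density := hρ
  measurable_velocity := hu
  measurable_pressure := hp
  essBounded := by
    refine ⟨max (max (1 + |R|) (|a| + Real.sqrt (2 * e))) (1 + |P|), ?_⟩
    rw [domain]
    filter_upwards [ae_glued_bounds hreg hv.2.1] with z hz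
    exact ⟨hz.1.trans ((le_max_left _ _).trans (le_max_left _ _)),
      hz.2.1.trans ((le_max_right _ _).trans (le_max_left _ _)),
      hz.2.2.trans (le_max_right _ _)⟩
  pos := ae_of_all _ hpos
  mass := glued_mass hσ hmass hreg hρ hu hv
  momentum := glued_momentum hσ hmom hreg hρ hu hp hv
  energy := glued_energy hσ hγ hR hen hreg hρ hu hp hv
  entropy := glued_entropy hσ hγ hR hmass hent hreg hρ hu hp hv

end Glue

/-! ### The barrier from the convex-integration lemma -/

/-- **Wild solutions from the convex-integration lemma (Markfelder 2021, Thm 8.3.1 for the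
symmetric two-shock data; = Al Baba–Klingenberg–Kreml–Mácha–Markfelder 2020).** If the
two-dimensional convex-integration lemma of Chiodaroli–De Lellis–Kreml holds, then for every
`1 < γ < 3` and `a > 0` the Riemann data `ρ = p = 1`, `u = (0, ±a)` admit a sequence of
admissible weak solutions of the full Euler system with density and pressure bounded below by
`1` and pairwise essentially different velocities: take the symmetric admissible fan
subsolution (`exists_fan_parameters`), a wild family on its middle wedge (the lemma with
`v₀ = 0`, `u₀ = diag(g, -g)`, `C = 2e`), and glue (`isAdmissibleWeakSolution_glued`).
[cite: Markfelder2021, Thm 8.3.1, Thm 8.3.4, Prop. 8.3.5, §8.3.3] [cite: ChiodaroliDeLellisKreml2015, Lemma 3.7 and Prop. 3.6] -/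
theorem WildSolutionsBarrier_of_convexIntegrationLemma2D (hCI : ConvexIntegrationLemma2D) :
    WildSolutionsBarrier := by
  intro γ a hγ1 hγ3 ha
  obtain ⟨R, P, σ, e, g, hR, hP, hσ, he, hg, hmass, hmom, hen, hent⟩ :=
    SymmetricTwoShock.exists_fan_parameters hγ1 hγ3 ha
  -- a wild family on the middle wedge
  have hpd : (((2 * e) / 2) • (1 : Matrix (Fin 2) (Fin 2) ℝ) -
      (Matrix.vecMulVec (0 : EuclideanSpace ℝ (Fin 2)) (0 : EuclideanSpace ℝ (Fin 2)) -
        Matrix.diagonal ![g, -g])).PosDef :=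
    posDef_rest_diag (by linarith)
  obtain ⟨v, hne, hv⟩ := hCI Γ₁[σ] (isOpen_fanMiddle (-σ) σ) (fanMiddle_nonempty hσ) 0
    (Matrix.diagonal ![g, -g]) (2 * e) (Matrix.isSymm_diagonal _)
    (by simp [Matrix.trace, Fin.sum_univ_two]) (by positivity) hpd
  classical
  -- the glued fields
  refine ⟨fun _ => (Γ₁[σ]).piecewise (fun _ => R) (fun _ => 1),
    fun n => (Γ₁[σ]).piecewise (v n) (fun z => collidingStreams a z.2),
    fun _ => (Γ₁[σ]).piecewise (fun _ => P) (fun _ => 1), fun n => ?_, fun n => ?_, ?_⟩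
  · -- admissible weak solutions
    have hm1 : MeasurableSet Γ₁[σ] := measurableSet_fanMiddle (-σ) σ
    have hcs : Measurable (collidingStreams a) := by
      unfold collidingStreams
      exact Measurable.ite (measurableSet_lt (by fun_prop) measurable_const) measurable_const
        measurable_const
    refine isAdmissibleWeakSolution_glued hσ hγ1 hR hmass hmom hen hent ⟨?_, ?_, ?_⟩
      (Measurable.piecewise hm1 measurable_const measurable_const)
      (Measurable.piecewise hm1 (hv n).1 (hcs.comp measurable_snd))
      (Measurable.piecewise hm1 measurable_const measurable_const) (fun z => ?_) (hv n)
    · intro z hz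
      have hz' : z ∉ Γ₁[σ] := fun h => absurd (hz.2.trans h.2.1) (lt_irrefl _)
      have hy : z.2 1 < 0 := hz.2.trans (by nlinarith [hz.1])
      simp only [Set.piecewise_eq_of_notMem (Γ₁[σ]) _ _ hz', collidingStreams, if_pos hy, and_self]
    · intro z hz
      simp only [Set.piecewise_eq_of_mem (Γ₁[σ]) _ _ hz, and_self]
    · intro z hz
      have hz' : z ∉ Γ₁[σ] := fun h => absurd (hz.2.trans h.2.2) (lt_irrefl _)
      have hy : ¬ z.2 1 < 0 := not_lt.mpr (le_of_lt (lt_trans (by nlinarith [hz.1]) hz.2))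
      simp only [Set.piecewise_eq_of_notMem (Γ₁[σ]) _ _ hz', collidingStreams, if_neg hy, and_self]
    · by_cases hz : z ∈ Γ₁[σ]
      · simp only [Set.piecewise_eq_of_mem (Γ₁[σ]) _ _ hz]; exact ⟨by linarith, by linarith⟩
      · simp only [Set.piecewise_eq_of_notMem (Γ₁[σ]) _ _ hz]; exact ⟨one_pos, one_pos⟩
  · -- density and pressure bounded below by `1`
    refine ⟨1, one_pos, ae_of_all _ fun z => ?_⟩
    by_cases hz : z ∈ Γ₁[σ]
    · simp only [Set.piecewise_eq_of_mem (Γ₁[σ]) _ _ hz]; exact ⟨hR.le, hP.le⟩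
    · simp only [Set.piecewise_eq_of_notMem (Γ₁[σ]) _ _ hz]; exact ⟨le_rfl, le_rfl⟩
  · -- pairwise essentially different velocities (already on the middle wedge)
    intro n n' hnn' heq
    refine hne n n' hnn' ?_
    have hsub : Γ₁[σ] ⊆ domain := fun z hz => ⟨hz.1, mem_univ _⟩
    have h1 := ae_restrict_of_ae_restrict_of_subset hsub heq
    filter_upwards [ae_restrict_mem (measurableSet_fanMiddle (-σ) σ), h1] with z hz h
    rw [Set.piecewise_eq_of_mem (Γ₁[σ]) _ _ hz, Set.piecewise_eq_of_mem (Γ₁[σ]) _ _ hz] at h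
    exact h

/-- **The barrier from the cylinder case of the convex-integration lemma.** It suffices to know
Lemma 3.7 of Chiodaroli–De Lellis–Kreml on balls (cylinders `]t₀ - r, t₀ + r[ × B_r(x₀)`) of
`ℝ × ℝ²` — the named fact `ConvexIntegrationLemma2DBall`, to which the lemma on arbitrary
non-empty open sets is reduced in `Literature/Analysis/FluidPDE/ConvexIntegration2DReduction.lean`
(Besicovitch covering and gluing of wild families, `convexIntegrationLemma2D_of_ball`). This is the
exact remaining unproved input of `WildSolutionsBarrier`.
[cite: ChiodaroliDeLellisKreml2015, Lemma 3.7 (case Ω = B_r(x₀) × ]t₀ - r, t₀ + r[) and proof of Prop. 3.6] [cite: Markfelder2021, Thm 8.3.1] -/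
theorem WildSolutionsBarrier_of_convexIntegrationLemma2DBall (h : ConvexIntegrationLemma2DBall) :
    WildSolutionsBarrier :=
  WildSolutionsBarrier_of_convexIntegrationLemma2D (convexIntegrationLemma2D_of_ball h)

end Literature.Barriers.AtomisticToContinuum

end
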